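import Summits.Langlands.Langlands.Theses.DyadicOddResidue
import Literature.NumberTheory.Automorphic.FontaineMazurHilbertTotallySplit
import Literature.NumberTheory.Automorphic.POrdinaryHeckeAlgebraGL2

/-!
# Line `close-approximation-cc` — checked skeleton for the crux
`Summit.Langlands.Langlands.Theses.DyadicOddResidue.DyadicEisensteinFM` (stmt-Langlands-18741)

Planner crux-plan, round 1, generation 1 (idea card `Cruxes/DyadicEisensteinFM/Ideas/close-approximation-cc.md`,
triage `TRIAGE-r1-1.md` / `TRIAGE-r1-2.md`: pass / pass; line card `Lines/close-approximation-cc.md`).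

THE CRUX (fixed). `ℓ = 2`; `ρ : Γ_ℚ → GL₂(ℚ̄₂)` continuous, residually NOT absolutely irreducible (Eisenstein
residue), irreducible, odd, unramified a.e., de Rham at `2` with distinct labelled Hodge–Tate weights ⟹ for every
level witness `hcpt` and `ι : ℚ̄₂ ≃ ℂ` an `L`-algebraic cuspidal `π` of `GL₂(𝔸_ℚ)` is Satake–Frobenius compatible
with `ρ` a.e. (`= IsAutomorphicAE ι hcpt ρ`, definitionally).

THE LEVER (card). Characteristic-ZERO "nice prime": a MODULAR point `ρ₁` lying on the irreducible component of the
global `2`-adic pseudo-deformation space through `ρ|_{Γ_F}` (`F` totally real, `2` totally split), produced by a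
`ϖ^C`-close modular approximation (Thorne, arXiv:2608.07186, Thm 2.12 — abstract form LANDED as
`Theorems.DyadicEisensteinFM.closeShareComponent`, p147143 — and §3–§4) and exploited by Pan's capture of the
component in the Eisenstein-localised completed (co)homology Hecke algebra (Pan, JAMS 35, §3–§4, transplanted to
a characteristic-0 prime with Newton–Thorne Taylor–Wiles data and Paškūnas–Tung's `p = 2` blocks), followed by
classicality over `F` and descent to `ℚ`.  The residual representation never enters.

RENDERING OF "COMPONENT" (the one modelling decision of this skeleton). The tree has no universal
pseudo-deformation ring, so an irreducible FAMILY is rendered functor-of-points style: a Chenevier determinant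
`D : PseudoRep2 (Γ_F) A` (accepted `Literature.NumberTheory.Automorphic.PseudoRep2`: trace + det) with values in a
compact Hausdorff Noetherian local DOMAIN `A` (hence a complete Noetherian local ring with finite residue field
and its `𝔪`-adic topology), continuous, unramified outside a finite set, totally odd (`det D(c) = -1`), residually
a sum of two characters; a POINT of the family is a continuous `x : A →+* ℚ̄₂`, and `ρ₂` LIES ON the family when
`x ∘ D.trace = tr ρ₂`.  "`ρ|_{Γ_F}` and `ρ₁` lie on a common irreducible component `Z` of `Spec R^{ps}`" becomes
"there is such a family through both" (take `A = 𝒪(Z)`).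

SHAPE (4 registered stubs, composition pure logic):
* `stub_inducedCase` (S_A; printed modulo the dictionary): `ρ|_{Γ_K}` reducible for a quadratic `K` ⟹ `ρ`
  automorphic (Hecke / automorphic induction of the algebraic Hecke character) — the CM leg of the card's P2.
* `stub_seededFamily` (S_B; OPEN, the HARDEST: card K1′ + K1 + Thm 2.12 + Lemma 4.2): for non-CM `ρ` there are a
  totally real `F`, Galois over `ℚ` with `2` totally split, and an `F`-family through `ρ|_{Γ_F}` carrying a
  CLASSICAL non-CM point `ρ₁` (regular `L`-algebraic cuspidal on `GL₂(𝔸_F)`).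
* `stub_automorphyPropagates` (S_C; OPEN: card K2 = characteristic-0 capture, + K3a = classicality over `F` at
  `2`): along such a seeded family, the restriction `ρ|_{Γ_F}` of an irreducible odd de Rham–regular `ρ` is
  automorphic over `F`.  (A weakening of Fontaine–Mazur over `F`: the extra handle is the classical point.)
* `stub_descentToQ` (S_D; printed modulo assembly: Brauer + solvable base change + compatible systems +
  Khare–Wintenberger/Kisin at a large prime — the exit of Thorne's Thm D and of Taylor's "Remarks on a conjecture
  of Fontaine and Mazur"; NOT solvable descent: potential modularity does not give a solvable `F`).
Composition `DyadicEisensteinFM_of : S.stub_inducedCase → S.stub_seededFamily → S.stub_automorphyPropagates →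
S.stub_descentToQ → DyadicEisensteinFM`: `by_cases` on "`ρ` becomes reducible over some quadratic field".

DISPROOF USED (`Cruxes/DyadicEisensteinFM/Disproof.lean`, cdisprove cycle 1, read in full 2026-08-17): verdict
NO KILL, no `_false_without_` theorem exists (§3: none can, short of ¬FM), `-- Targets: none`.  §3 load-bearing
map honoured: `hres` is consumed by S_B only (the family is residually Eisenstein — Pan's setting), `hirr` by all
four, `hodd` by S_B/S_C/S_D (the family is totally odd; `det ρ₂(c) = x(D.det c) = -1` is how oddness survives in
characteristic 0, cf. §0 "oddness residually invisible": no stub ever reduces `c` mod 2), `hunr` by S_A/S_B/S_D,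
the de Rham clause by all.  §1 `dyadicEisensteinFM_iff_atTwo`: the skeleton works at the literal prime `2`
(`subst`).  §4 (a.e. form tight): every conclusion is a.e.  Landed Negative lemmas (`Negative/*.lean`, 4 files):
hygiene lemmas, no `¬`-statement; no stub is an instance they refute.  `ledger negatives --problem Langlands`:
unrelated (SplitPrimeInduction, OrdinaryPrimeTransport, K3KugaSatake, …).
-/

set_option linter.dupNamespace false
set_option linter.unusedVariables false
set_option linter.overlappingInstances false

noncomputable section

namespace Summit.Langlands.Langlands.Cruxes.DyadicEisensteinFM.CloseApproximationCc

open Summit.Langlands.Langlands.Theses.DyadicOddResidue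
open Literature.NumberTheory.Automorphic Literature.NumberTheory.GaloisRepresentations
open Literature.NumberTheory.PAdicHodge
open NumberField IsDedekindDomain Filter Field

/-! ## 1. The statements of the four stubs (`S.stub_*`, readable form; the registered `stub_*` of §2 restate
them verbatim with fully qualified names, `stub_*_iff` certifies the match by `Iff.rfl`) -/

/-- **STUB A — `inducedCase` (the CM / dihedral leg; size M mathematically, L in Lean; PRINTED modulo the
automorphic dictionary).**  `ρ : Γ_ℚ → GL₂(ℚ̄₂)` irreducible, unramified a.e., de Rham at `2` with distinct
labelled Hodge–Tate weights, and REDUCIBLE on `Γ_K` for some quadratic number field `K` ⟹ `ρ` is automorphic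
(`IsAutomorphicAE`).  Intended proof: Clifford ⟹ `ρ ≅ Ind_{Γ_K}^{Γ_ℚ} θ`; distinct Hodge–Tate weights force `K`
imaginary quadratic and `θ` Hodge–Tate, hence (Serre–Tate, CFT) the `2`-adic avatar of an algebraic Hecke
character `χ` of `K` with `χ ≠ χ^c` (irreducibility); `π(χ)` = automorphic induction `GL₁/K → GL₂/ℚ`
(Hecke 1927 / Jacquet–Langlands; tree: `AutomorphicInductionCharacter*`, `automorphicInduction_cyclic_cuspidal`)
is cuspidal and, twisted to be `L`-algebraic, Satake–Frobenius compatible with `ρ` a.e.  WHY IT MIGHT FAIL: only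
the tree's dictionary (Hecke character ↔ `2`-adic character with its infinity type; `L`-normalisation of
`SatakeFrobCompatibleAt`); no open mathematics.  [Hecke1927; SerreAbelianLadic1968 Ch. III; JacquetLanglands1970 §12] -/
def S.stub_inducedCase : Prop :=
  ∀ (ρ : FramedGaloisRep ℚ (PadicAlgCl 2) 2), ρ.toGaloisRep.IsIrreducible →
    (∀ᶠ v : HeightOneSpectrum (𝓞 ℚ) in cofinite, ρ.IsUnramifiedAt v) →
    (∀ (v : HeightOneSpectrum (𝓞 ℚ)) (hv : ((2 : ℕ) : 𝓞 ℚ) ∈ v.asIdeal),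
      (fontainePstAdicCompletion v 2 hv).IsDeRhamFramed (ρ.toLocal v) ∧
      ∀ τ : v.adicCompletion ℚ →+* PadicAlgCl 2, Continuous τ →
        (ρ.labelledHodgeTateWeightsAt v (fontainePstAdicCompletion v 2 hv).algebra
          (fontainePstAdicCompletion v 2 hv).𝔅 τ).Nodup) →
    (∃ (K : Type) (_ : Field K) (_ : NumberField K),
      Module.finrank ℚ K = 2 ∧ ¬ (ρ.restrictField K).toGaloisRep.IsIrreducible) →
    ∀ (hcpt : isCompact_glFiniteIntegralLevel 2 ℚ) (ι : PadicAlgCl 2 ≃+* ℂ), IsAutomorphicAE ι hcpt ρ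

/-- **STUB B — `seededFamily` (THE HARDEST; OPEN; card K1′ + K1 + Thorne Thm 2.12 + Lemma 4.2).**  For `ρ` with the
crux's hypotheses and NOT induced from any quadratic field, there are: a totally real number field `F`, Galois over
`ℚ`, with `2 ∤ d_F` and every `w ∣ 2` of residue degree 1 (`2` totally split), such that `ρ|_{Γ_F}` is irreducible,
and an `F`-FAMILY `(A, D)` — `A` compact Hausdorff Noetherian local domain, `D : PseudoRep2 Γ_F A` continuous,
unramified outside a finite set, totally odd, residually `χ₁ ⊕ χ₂` — with two continuous `ℚ̄₂`-points: `x₂`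
carrying `tr ρ|_{Γ_F}`, and `x₁` carrying `tr ρ₁` for a CLASSICAL NON-CM `ρ₁` (attached a.e., for every `ι`, to
a cuspidal `L`-algebraic `π₁` of `GL₂(𝔸_F)` with a regular infinity type; irreducible on every quadratic `K/F`).
Intended proof (the card's spine): `Z` := an irreducible component through `x_ρ` of the determinant-UNFIXED odd
pseudo-deformation space of `ρ̄^{ss}` over `ℚ` (Chenevier; Noetherian by `Φ₂`; dim `≥ 4` by the characteristic-0
tangent count `h¹ - h² = 3` plus the twist direction); (K1′) `Z` contains a point `y`, irreducible, non-CM,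
POTENTIALLY BARSOTTI–TATE at `2` (genuinely, not up to twist: the non-algebraic twist `5 ↦ 5^{(k-2)/2}` that the
fixed-determinant space forces — triage r1-2, `v₂(5^{k-2} - 1) = 2 + v₂(k-2)` — is a direction INSIDE the unfixed
space), preferably a smooth point of `Z[1/2]`; (K1) potential modularity with `ϖ^C`-precision (Thorne §3:
Honda–Tate + geometry of numbers + Moret-Bailly; Taylor 2002/2006 for `C = 1`): a Galois totally real `F`, `2`
totally split and `T`-split for Thorne's finite set `T = T(y)` (Lemma 4.2: then `C(y|_{Γ_F}) = C(y)`, which breaks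
the circle "precision depends on `F`, `F` depends on precision"), and an HBAV `𝒜/F` with `V_ϖ(𝒜) ≡ y|_{Γ_F} mod
ϖ^{C}`, modular over `F` (so `ρ₁ := V_ϖ(𝒜) ⊗ ε^a` is classical); (2.12) `ρ₁` lies on the component `Z_F ⊇ res(Z)`
of the `F`-space (run Thm 2.12 where both points live — on `R^{ps}_F` completed at the smooth point `y|_{Γ_F}`, or
on the patched `R_∞` as Thorne p. 46 does; `A := 𝒪(Z_F)`).  LINKING CAVEAT (why this is ONE stub): membership in
a component is not functorial along sub-families — if `y|_{Γ_F}` were a singular point, the component through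
`ρ₁` and `y|_{Γ_F}` given by 2.12 need not contain `res(Z) ∋ ρ|_{Γ_F}`; the prover owns the joint choice of `y`.
WHY IT MIGHT FAIL: (K1′) at `p = 2` neither the finiteness `R^{ps}_{glob}/R^{ps}_{loc,2}` (Allen–Calegari style)
nor a positivity argument making the expected-dimension-0 intersection "image of `Z` ∩ pot-BT loci" NON-EMPTY is
in print (X. Zhang arXiv:2512.21249 and Allen 2019 are `p` odd and use Pan's `R = 𝕋` as input) — the
PatchingLocalComponent moral ("a component without a known point is invisible") bites at the seed (triage r1-2);
(K1) local realisability at `w ∣ 2` with `F_w = ℚ₂`: an abelian surface/HBAV over `ℚ₂` with Tate module `≡ y|_{Γ_{ℚ₂}}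
mod ϖ^C` for `y` only POTENTIALLY crystalline (Thorne §3 writes the ordinary case).  Honest reach today: the
potentially-BT cell of the crux (where `y = ρ` works).  Degenerate check: if `ρ|_{Γ_F}` is itself automorphic the
constant family `A = 𝒪_E`, `D = (tr, det) ρ|_{Γ_F}`, `ρ₁ = ρ|_{Γ_F}` satisfies the stub — so STUB B is implied by
(and strictly weaker than) potential automorphy of `ρ` over a `2`-split Galois totally real field.
[Thorne2026 = arXiv:2608.07186 Thm 2.12 (p.10), §3 (Thm 3.2), Thm 4.1 + Lemma 4.2 (p.35), p.46, p.52 (proof of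
Thm B); Chenevier2014 §1–3; Taylor2002FM; Taylor2006MeroCont; GHK10; XZhang2025 = arXiv:2512.21249;
AllenCalegari2014; Allen2019] -/
def S.stub_seededFamily : Prop :=
  ∀ (ρ : FramedGaloisRep ℚ (PadicAlgCl 2) 2), ¬ ρ.IsResiduallyAbsIrreducible → ρ.toGaloisRep.IsIrreducible →
    ρ.IsOdd → (∀ᶠ v : HeightOneSpectrum (𝓞 ℚ) in cofinite, ρ.IsUnramifiedAt v) →
    (∀ (v : HeightOneSpectrum (𝓞 ℚ)) (hv : ((2 : ℕ) : 𝓞 ℚ) ∈ v.asIdeal),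
      (fontainePstAdicCompletion v 2 hv).IsDeRhamFramed (ρ.toLocal v) ∧
      ∀ τ : v.adicCompletion ℚ →+* PadicAlgCl 2, Continuous τ →
        (ρ.labelledHodgeTateWeightsAt v (fontainePstAdicCompletion v 2 hv).algebra
          (fontainePstAdicCompletion v 2 hv).𝔅 τ).Nodup) →
    (∀ (K : Type) [Field K] [NumberField K], Module.finrank ℚ K = 2 →
      (ρ.restrictField K).toGaloisRep.IsIrreducible) →
    ∃ (F : Type) (_ : Field F) (_ : NumberField F), IsTotallyReal F ∧ IsGalois ℚ F ∧
      ¬ ((2 : ℤ) ∣ NumberField.discr F) ∧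
      (∀ w : HeightOneSpectrum (𝓞 F), ((2 : ℕ) : 𝓞 F) ∈ w.asIdeal → w.residueCard = 2) ∧
      (ρ.restrictField F).toGaloisRep.IsIrreducible ∧
      ∃ (A : Type) (_ : CommRing A) (_ : IsDomain A) (_ : IsNoetherianRing A) (_ : IsLocalRing A)
        (_ : TopologicalSpace A) (_ : IsTopologicalRing A) (_ : CompactSpace A) (_ : T2Space A)
        (D : PseudoRep2 (absoluteGaloisGroup F) A) (x₁ x₂ : A →+* PadicAlgCl 2)
        (ρ₁ : FramedGaloisRep F (PadicAlgCl 2) 2),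
        (Continuous D.trace ∧
          (∃ S : Set (HeightOneSpectrum (𝓞 F)), S.Finite ∧ ∀ v ∉ S, ∀ 𝔓 ∈ v.primesAbove,
            ∀ σ ∈ 𝔓.inertia (absoluteGaloisGroup F), D.det σ = 1 ∧
              ∀ τ : absoluteGaloisGroup F, D.trace (τ * σ) = D.trace τ) ∧
          (∀ (φ : F →+* ℝ) (c : absoluteGaloisGroup F), IsComplexConjugation φ c →
            ((D.det c : Aˣ) : A) = -1) ∧
          (∃ (k : Type) (_ : Field k) (i : IsLocalRing.ResidueField A →+* k)
            (χ₁ χ₂ : absoluteGaloisGroup F →* kˣ),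
            (D.map (IsLocalRing.residue A)).map i = PseudoRep2.ofCharacters χ₁ χ₂)) ∧
        (Continuous x₁ ∧ Continuous x₂ ∧ (∀ σ, x₁ (D.trace σ) = (ρ₁ σ).val.trace) ∧
          (∀ σ, x₂ (D.trace σ) = ((ρ.restrictField F) σ).val.trace)) ∧
        ((∀ (K : Type) [Field K] [NumberField K] [Algebra F K], Module.finrank F K = 2 →
            (ρ₁.restrictField K).toGaloisRep.IsIrreducible) ∧
          (∀ (hF : isCompact_glFiniteIntegralLevel 2 F) (ι : PadicAlgCl 2 ≃+* ℂ),
            ∃ π₁ : CuspidalAutomorphicRepData 2 F hF, π₁.1.IsLAlgebraic ∧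
              (∃ T : InfinityType F 2, π₁.1.HasInfinityType T ∧ T.IsRegular) ∧
              SatakeFrobCompatibleAE ι π₁.1 ρ₁))

/-- **STUB C — `automorphyPropagates` (OPEN; card K2 = characteristic-0 capture, then K3a = classicality over `F` at
`p = 2`; size XL).**  `F` totally real with `2 ∤ d_F` and `2` totally split; `(A, D)` an `F`-family as in STUB B with a
classical non-CM point `ρ₁` (via `x₁`); `ρ : Γ_ℚ → GL₂(ℚ̄₂)` irreducible, odd, unramified a.e., de Rham at `2` with distinct
labelled weights, with `ρ|_{Γ_F}` irreducible and lying on the family (via `x₂`) ⟹ `ρ|_{Γ_F}` is automorphic over `F`: for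
every `hF`, `ι` some cuspidal `L`-algebraic `π` of `GL₂(𝔸_F)` with a regular infinity type is Satake–Frobenius
compatible with `ρ|_{Γ_F}` a.e.  This is Fontaine–Mazur over `F` WEAKENED by the handle "on a common component with a
classical point", so it is true if FM is; its intended PROOF is the card's transplant: (capture) `𝔮 := ker x₁` is a
characteristic-0 one-dimensional prime of `R^{ps}_{F,S}` (det unfixed, or fixed after separating the twist
variable) which is pro-modular (`ρ₁` classical ⟹ a point of the Eisenstein-localised big Hecke algebra `𝕋_𝔪` of the
completed cohomology `H⁰` of the totally definite quaternion algebra over `F`, or over a solvable `F″/F` of even degree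
— descend at the end by ACC+ Prop. 6.5.13 (2), tree fact `ACC2023.solubleDescent_isAutomorphic`); patch the `𝔮`-adically
completed homology (Pan §4, Thm 4.1.6 shape) with Newton–Thorne CHARACTERISTIC-0 Taylor–Wiles data (enormous image
of `ρ₁` ⟸ non-CM + regular), local input at `w ∣ 2` = Paškūnas–Tung block finiteness for `GL₂(ℚ₂)` + Pan's
GK-dimension bound `dim 𝕋_𝔪 ≥ 1 + 2[F:ℚ]` (his Thm 3.6.1 at `p = 2`) ⟹ every component of `Spec R^{ps}` through `𝔮`,
in particular the image of `Spec A`, lies in `Spec 𝕋_𝔪`: `x₂` is pro-modular; (classicality) Pan's Cor. 3.5.12 at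
`p = 2` (local–global compatibility Thm 3.5.x via the Bernstein centre of the Paškūnas–Tung blocks, CDP14 locally
algebraic vectors) for `ρ|_{Γ_{F_w}}` irreducible, Hida/Skinner–Wiles control for `ρ|_{Γ_{F_w}}` reducible; then
Jacquet–Langlands to `GL₂(𝔸_F)`.  The local data at `w ∣ 2` are read off `ρ|_{Γ_{ℚ₂}}` because `F_w = ℚ₂` (that is why
the de Rham clause is the crux's own, over `ℚ`).  WHY IT MIGHT FAIL: (K2) Pan's full-support step for the patched
module at `𝔮` uses `M/𝔮` as a smooth `𝔽⟦T⟧`-representation of `GL₂(ℚ_p)` (`p ∈ 𝔮`); at a characteristic-0 `𝔮` the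
fibre is a lattice in a Banach representation and full support on `Spec (R_∞)^∧_𝔮` must come from regularity of the
local rings at `𝔮_w` (fine generically, but `ρ₁` is de Rham, not generic) or from a Banach-block argument not in
print — the card's "cheapest falsifier: list every use of `p ∈ 𝔮` in Pan §4.2–4.4"; (K3a) the Bernstein-centre
description `E_𝔅` of the `ω = 1` blocks of `GL₂(ℚ₂)` is exactly what Paškūnas–Tung leave uncomputed (§1.2 p.6, "it
seems likely"); barrier `PatchingLocalComponentBarrier` is ENGAGED at the capture and evaded only if `𝔮` can be taken
smooth on `R_loc[1/2]`; barriers `PaskunasCentreFinitenessFails` / `ModPLanglandsGL2BeyondQp` force `F_w = ℚ₂`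
(hence the `2`-split clause).  [Pan2022 = arXiv:1901.07166 §3 (Thm 3.5.x lgc, Cor 3.5.12, Thm 3.6.1), §4 (Def 4.1.4,
Thm 4.1.6); NewtonThorne2023 Prop 2.15, Lemma 2.19; Thorne2026 §4 (Lemmas 4.3–4.7); PaskunasTung2021 Thms 1.1, 1.3,
7.1, §1.2; ColmezDospinescuPaskunas2014 Thm 1.3; GeeNewton2020; AllenCalegariCaraianiGeeEtAl2023 Prop 6.5.13] -/
def S.stub_automorphyPropagates : Prop :=
  ∀ (ρ : FramedGaloisRep ℚ (PadicAlgCl 2) 2), ρ.toGaloisRep.IsIrreducible → ρ.IsOdd →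
    (∀ᶠ v : HeightOneSpectrum (𝓞 ℚ) in cofinite, ρ.IsUnramifiedAt v) →
    (∀ (v : HeightOneSpectrum (𝓞 ℚ)) (hv : ((2 : ℕ) : 𝓞 ℚ) ∈ v.asIdeal),
      (fontainePstAdicCompletion v 2 hv).IsDeRhamFramed (ρ.toLocal v) ∧
      ∀ τ : v.adicCompletion ℚ →+* PadicAlgCl 2, Continuous τ →
        (ρ.labelledHodgeTateWeightsAt v (fontainePstAdicCompletion v 2 hv).algebra
          (fontainePstAdicCompletion v 2 hv).𝔅 τ).Nodup) →
    ∀ (F : Type) [Field F] [NumberField F], IsTotallyReal F → ¬ ((2 : ℤ) ∣ NumberField.discr F) →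
    (∀ w : HeightOneSpectrum (𝓞 F), ((2 : ℕ) : 𝓞 F) ∈ w.asIdeal → w.residueCard = 2) →
    (ρ.restrictField F).toGaloisRep.IsIrreducible →
    ∀ (A : Type) [CommRing A] [IsDomain A] [IsNoetherianRing A] [IsLocalRing A] [TopologicalSpace A]
      [IsTopologicalRing A] [CompactSpace A] [T2Space A]
      (D : PseudoRep2 (absoluteGaloisGroup F) A) (x₁ x₂ : A →+* PadicAlgCl 2)
      (ρ₁ : FramedGaloisRep F (PadicAlgCl 2) 2),
      (Continuous D.trace ∧
        (∃ S : Set (HeightOneSpectrum (𝓞 F)), S.Finite ∧ ∀ v ∉ S, ∀ 𝔓 ∈ v.primesAbove,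
          ∀ σ ∈ 𝔓.inertia (absoluteGaloisGroup F), D.det σ = 1 ∧
            ∀ τ : absoluteGaloisGroup F, D.trace (τ * σ) = D.trace τ) ∧
        (∀ (φ : F →+* ℝ) (c : absoluteGaloisGroup F), IsComplexConjugation φ c →
          ((D.det c : Aˣ) : A) = -1) ∧
        (∃ (k : Type) (_ : Field k) (i : IsLocalRing.ResidueField A →+* k)
          (χ₁ χ₂ : absoluteGaloisGroup F →* kˣ),
          (D.map (IsLocalRing.residue A)).map i = PseudoRep2.ofCharacters χ₁ χ₂)) →
      (Continuous x₁ ∧ Continuous x₂ ∧ (∀ σ, x₁ (D.trace σ) = (ρ₁ σ).val.trace) ∧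
        (∀ σ, x₂ (D.trace σ) = ((ρ.restrictField F) σ).val.trace)) →
      ((∀ (K : Type) [Field K] [NumberField K] [Algebra F K], Module.finrank F K = 2 →
          (ρ₁.restrictField K).toGaloisRep.IsIrreducible) ∧
        (∀ (hF : isCompact_glFiniteIntegralLevel 2 F) (ι : PadicAlgCl 2 ≃+* ℂ),
          ∃ π₁ : CuspidalAutomorphicRepData 2 F hF, π₁.1.IsLAlgebraic ∧
            (∃ T : InfinityType F 2, π₁.1.HasInfinityType T ∧ T.IsRegular) ∧
            SatakeFrobCompatibleAE ι π₁.1 ρ₁)) →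
      ∀ (hF : isCompact_glFiniteIntegralLevel 2 F) (ι : PadicAlgCl 2 ≃+* ℂ),
        ∃ π : CuspidalAutomorphicRepData 2 F hF, π.1.IsLAlgebraic ∧
          (∃ T : InfinityType F 2, π.1.HasInfinityType T ∧ T.IsRegular) ∧
          SatakeFrobCompatibleAE ι π.1 (ρ.restrictField F)

/-- **STUB D — `descentToQ` (PRINTED modulo assembly; size M mathematically, L–XL in Lean; card K3b, RE-ROUTED).**
`ρ : Γ_ℚ → GL₂(ℚ̄₂)` irreducible, odd, unramified a.e., de Rham at `2` with distinct labelled weights; `F` totally real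
and GALOIS over `ℚ` (no solvability: Moret-Bailly fields are not solvable); `ρ|_{Γ_F}` irreducible and automorphic
over `F` (cuspidal `L`-algebraic with regular infinity type, a.e. compatible, for every `hF`, `ι`) ⟹ `ρ` is automorphic
over `ℚ` (`IsAutomorphicAE ι hcpt ρ`).  Intended proof — the exit of Thorne's Thm D (p.3: "the theorem implies that
`ρ` lives in a weight 0, rank 2 compatible system, and the modularity of such compatible systems is a well-known
consequence of Serre's conjecture [Kha10]") in general regular weight: Brauer's theorem on `Gal(F/ℚ)` + cyclic base
change/descent (Langlands 1980; ACC+ Prop 6.5.13, tree fact `ACC2023.solubleDescent_isAutomorphic`) ⟹ `ρ|_{Γ_{F_i}}`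
automorphic for every `F_i ⊆ F` with `F/F_i` solvable ⟹ (Taylor, Doc. Math. 2006 §5–6 / BLGGT 2014 §5.5) `ρ` is a
member `r_{λ₂}` of a weakly compatible system `{r_λ}` of odd two-dimensional representations of `Γ_ℚ`, pure and with
Hodge–Tate weights those of `ρ`; for `λ ∣ l` large `r_λ` is crystalline in the Fontaine–Laffaille range with `r̄_λ`
irreducible (rank 2, non-CM by STUB A's complement or CM and then modular), Khare–Wintenberger ⟹ `r̄_λ` modular,
Kisin ⟹ `r_λ` modular ⟹ the system, hence `ρ`, is that of a newform; finish with the newform → `L`-algebraic `π`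
dictionary (`Theorems.oddPrimesRegularFM_of_tateTwistModularity` pattern, `ℓ` free).  WHY IT MIGHT FAIL: no open
mathematics; Lean-side the compatible-system existence (Taylor's `⟨r_λ, r_λ⟩ = 1` argument) and the dictionary are
unvendored (file them as named facts).  [Taylor2006MeroCont Thm 6.6 / Cor; BLGGT2014 Thm 5.5.1; KhareWintenberger2009;
Kisin2009; Langlands1980BaseChange; AllenCalegariCaraianiGeeEtAl2023 Prop 6.5.13; Thorne2026 p.3] -/
def S.stub_descentToQ : Prop :=
  ∀ (ρ : FramedGaloisRep ℚ (PadicAlgCl 2) 2), ρ.toGaloisRep.IsIrreducible → ρ.IsOdd →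
    (∀ᶠ v : HeightOneSpectrum (𝓞 ℚ) in cofinite, ρ.IsUnramifiedAt v) →
    (∀ (v : HeightOneSpectrum (𝓞 ℚ)) (hv : ((2 : ℕ) : 𝓞 ℚ) ∈ v.asIdeal),
      (fontainePstAdicCompletion v 2 hv).IsDeRhamFramed (ρ.toLocal v) ∧
      ∀ τ : v.adicCompletion ℚ →+* PadicAlgCl 2, Continuous τ →
        (ρ.labelledHodgeTateWeightsAt v (fontainePstAdicCompletion v 2 hv).algebra
          (fontainePstAdicCompletion v 2 hv).𝔅 τ).Nodup) →
    ∀ (F : Type) [Field F] [NumberField F], IsTotallyReal F → IsGalois ℚ F →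
    (ρ.restrictField F).toGaloisRep.IsIrreducible →
    (∀ (hF : isCompact_glFiniteIntegralLevel 2 F) (ι : PadicAlgCl 2 ≃+* ℂ),
      ∃ π : CuspidalAutomorphicRepData 2 F hF, π.1.IsLAlgebraic ∧
        (∃ T : InfinityType F 2, π.1.HasInfinityType T ∧ T.IsRegular) ∧
        SatakeFrobCompatibleAE ι π.1 (ρ.restrictField F)) →
    ∀ (hcpt : isCompact_glFiniteIntegralLevel 2 ℚ) (ι : PadicAlgCl 2 ≃+* ℂ), IsAutomorphicAE ι hcpt ρ

/-! ## 2. The four registered stubs (the only `sorry`s of the line; statements = §1 verbatim, fully qualified, so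
that a Theorems-side `--supports stmt-Langlands-18741` proof can restate them textually) -/

/-- **stub_inducedCase** — STUB A, registered form (statement = `S.stub_inducedCase`, see its docstring).
[M (math) / L (Lean): Clifford + Hodge–Tate characters are locally algebraic + CFT + automorphic induction `GL₁/K → GL₂/ℚ` + the `L`-algebraic Satake dictionary.] -/
theorem stub_inducedCase : ∀ (ρ : Literature.NumberTheory.GaloisRepresentations.FramedGaloisRep ℚ (PadicAlgCl 2) 2), ρ.toGaloisRep.IsIrreducible → (∀ᶠ v : IsDedekindDomain.HeightOneSpectrum (NumberField.RingOfIntegers ℚ) in Filter.cofinite, ρ.IsUnramifiedAt v) → (∀ (v : IsDedekindDomain.HeightOneSpectrum (NumberField.RingOfIntegers ℚ)) (hv : ((2 : ℕ) : NumberField.RingOfIntegers ℚ) ∈ v.asIdeal), (Literature.NumberTheory.PAdicHodge.fontainePstAdicCompletion v 2 hv).IsDeRhamFramed (ρ.toLocal v) ∧ ∀ τ : v.adicCompletion ℚ →+* PadicAlgCl 2, Continuous τ → (ρ.labelledHodgeTateWeightsAt v (Literature.NumberTheory.PAdicHodge.fontainePstAdicCompletion v 2 hv).algebra (Literature.NumberTheory.PAdicHodge.fontainePstAdicCompletion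 v 2 hv).𝔅 τ).Nodup) → (∃ (K : Type) (_ : Field K) (_ : NumberField K), Module.finrank ℚ K = 2 ∧ ¬ (ρ.restrictField K).toGaloisRep.IsIrreducible) → ∀ (hcpt : Literature.NumberTheory.Automorphic.isCompact_glFiniteIntegralLevel 2 ℚ) (ι : PadicAlgCl 2 ≃+* ℂ), Literature.NumberTheory.Automorphic.IsAutomorphicAE ι hcpt ρ := by
  sorry

/-- **stub_seededFamily** — STUB B (hardest), registered form (statement = `S.stub_seededFamily`, see its docstring).
[XL, OPEN — THE HARDEST: a potentially Barsotti–Tate point on the determinant-unfixed Eisenstein component through `ρ` (K1′), `ϖ^C`-close potential modularity by HBAVs over a `2`-split Galois totally real `F` (K1, Thorne §3), Thm 2.12 + Lemma 4.2 to put the approximant on the component (linking at a smooth point).] -/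
theorem stub_seededFamily : ∀ (ρ : Literature.NumberTheory.GaloisRepresentations.FramedGaloisRep ℚ (PadicAlgCl 2) 2), ¬ ρ.IsResiduallyAbsIrreducible → ρ.toGaloisRep.IsIrreducible → ρ.IsOdd → (∀ᶠ v : IsDedekindDomain.HeightOneSpectrum (NumberField.RingOfIntegers ℚ) in Filter.cofinite, ρ.IsUnramifiedAt v) → (∀ (v : IsDedekindDomain.HeightOneSpectrum (NumberField.RingOfIntegers ℚ)) (hv : ((2 : ℕ) : NumberField.RingOfIntegers ℚ) ∈ v.asIdeal), (Literature.NumberTheory.PAdicHodge.fontainePstAdicCompletion v 2 hv).IsDeRhamFramed (ρ.toLocal v) ∧ ∀ τ : v.adicCompletion ℚ →+* PadicAlgCl 2, Continuous τ → (ρ.labelledHodgeTateWeightsAt v (Literature.NumberTheory.PAdicHodge.fontainePstAdicCompletion v 2 hv).algebra (Literature.NumberTheory.PAdicHodge.fontainePstAdicCompletion v 2 hv).𝔅 τ).Nodup) → (∀ (K : Type) [Field K] [NumberField K], Module.finrank ℚ K = 2 → (ρ.restrictField K).toGaloisRep.IsIrreducible) → ∃ (F : Type) (_ : Field F) (_ :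 NumberField F), NumberField.IsTotallyReal F ∧ IsGalois ℚ F ∧ ¬ ((2 : ℤ) ∣ NumberField.discr F) ∧ (∀ w : IsDedekindDomain.HeightOneSpectrum (NumberField.RingOfIntegers F), ((2 : ℕ) : NumberField.RingOfIntegers F) ∈ w.asIdeal → w.residueCard = 2) ∧ (ρ.restrictField F).toGaloisRep.IsIrreducible ∧ ∃ (A : Type) (_ : CommRing A) (_ : IsDomain A) (_ : IsNoetherianRing A) (_ : IsLocalRing A) (_ : TopologicalSpace A) (_ : IsTopologicalRing A) (_ : CompactSpace A) (_ : T2Space A) (D : Literature.NumberTheory.Automorphic.PseudoRep2 (Field.absoluteGaloisGroup F) A) (x₁ x₂ : A →+* PadicAlgCl 2) (ρ₁ : Literature.NumberTheory.GaloisRepresentations.FramedGaloisRep F (PadicAlgCl 2) 2), (Continuous D.trace ∧ (∃ S : Set (IsDedekindDomain.HeightOneSpectrum (NumberField.RingOfIntegers F)), S.Finite ∧ ∀ v ∉ S, ∀ 𝔓 ∈ v.primesAbove, ∀ σ ∈ 𝔓.inertia (Field.absoluteGaloisGroup F), D.det σ = 1 ∧ ∀ τ : Field.absoluteGaloisGroup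 F, D.trace (τ * σ) = D.trace τ) ∧ (∀ (φ : F →+* ℝ) (c : Field.absoluteGaloisGroup F), Literature.NumberTheory.GaloisRepresentations.IsComplexConjugation φ c → ((D.det c : Aˣ) : A) = -1) ∧ (∃ (k : Type) (_ : Field k) (i : IsLocalRing.ResidueField A →+* k) (χ₁ χ₂ : Field.absoluteGaloisGroup F →* kˣ), (D.map (IsLocalRing.residue A)).map i = Literature.NumberTheory.Automorphic.PseudoRep2.ofCharacters χ₁ χ₂)) ∧ (Continuous x₁ ∧ Continuous x₂ ∧ (∀ σ, x₁ (D.trace σ) = (ρ₁ σ).val.trace) ∧ (∀ σ, x₂ (D.trace σ) = ((ρ.restrictField F) σ).val.trace)) ∧ ((∀ (K : Type) [Field K] [NumberField K] [Algebra F K], Module.finrank F K = 2 → (ρ₁.restrictField K).toGaloisRep.IsIrreducible) ∧ (∀ (hF : Literature.NumberTheory.Automorphic.isCompact_glFiniteIntegralLevel 2 F) (ι : PadicAlgCl 2 ≃+* ℂ), ∃ π₁ : Literature.NumberTheory.Automorphic.CuspidalAutomorphicRepData 2 F hF, π₁.1.IsLAlgebraic ∧ (∃ T : Literature.NumberTheory.Automorphic.InfinityType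 F 2, π₁.1.HasInfinityType T ∧ T.IsRegular) ∧ Literature.NumberTheory.Automorphic.SatakeFrobCompatibleAE ι π₁.1 ρ₁)) := by
  sorry

/-- **stub_automorphyPropagates** — STUB C, registered form (statement = `S.stub_automorphyPropagates`, see its docstring).
[XL, OPEN: characteristic-0 capture at `𝔮 = ker x₁` (Pan §4 transplanted with Newton–Thorne TW data and Paškūnas–Tung blocks) + classicality over `F` at `2` (Pan Cor 3.5.12 / Hida control) + Jacquet–Langlands (+ ACC+ 6.5.13 descent if an even-degree solvable `F″/F` is used).] -/
theorem stub_automorphyPropagates : ∀ (ρ : Literature.NumberTheory.GaloisRepresentations.FramedGaloisRep ℚ (PadicAlgCl 2) 2), ρ.toGaloisRep.IsIrreducible → ρ.IsOdd → (∀ᶠ v : IsDedekindDomain.HeightOneSpectrum (NumberField.RingOfIntegers ℚ) in Filter.cofinite, ρ.IsUnramifiedAt v) → (∀ (v : IsDedekindDomain.HeightOneSpectrum (NumberField.RingOfIntegers ℚ)) (hv : ((2 : ℕ) : NumberField.RingOfIntegers ℚ) ∈ v.asIdeal), (Literature.NumberTheory.PAdicHodge.fontainePstAdicCompletion v 2 hv).IsDeRhamFramed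 (ρ.toLocal v) ∧ ∀ τ : v.adicCompletion ℚ →+* PadicAlgCl 2, Continuous τ → (ρ.labelledHodgeTateWeightsAt v (Literature.NumberTheory.PAdicHodge.fontainePstAdicCompletion v 2 hv).algebra (Literature.NumberTheory.PAdicHodge.fontainePstAdicCompletion v 2 hv).𝔅 τ).Nodup) → ∀ (F : Type) [Field F] [NumberField F], NumberField.IsTotallyReal F → ¬ ((2 : ℤ) ∣ NumberField.discr F) → (∀ w : IsDedekindDomain.HeightOneSpectrum (NumberField.RingOfIntegers F), ((2 : ℕ) : NumberField.RingOfIntegers F) ∈ w.asIdeal → w.residueCard = 2) → (ρ.restrictField F).toGaloisRep.IsIrreducible → ∀ (A : Type) [CommRing A] [IsDomain A] [IsNoetherianRing A] [IsLocalRing A] [TopologicalSpace A] [IsTopologicalRing A] [CompactSpace A] [T2Space A] (D : Literature.NumberTheory.Automorphic.PseudoRep2 (Field.absoluteGaloisGroup F) A) (x₁ x₂ : A →+* PadicAlgCl 2) (ρ₁ : Literature.NumberTheory.GaloisRepresentations.FramedGaloisRep F (PadicAlgCl 2) 2), (Continuous D.trace ∧ (∃ S : Set (IsDedekindDomain.HeightOneSpectrum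 (NumberField.RingOfIntegers F)), S.Finite ∧ ∀ v ∉ S, ∀ 𝔓 ∈ v.primesAbove, ∀ σ ∈ 𝔓.inertia (Field.absoluteGaloisGroup F), D.det σ = 1 ∧ ∀ τ : Field.absoluteGaloisGroup F, D.trace (τ * σ) = D.trace τ) ∧ (∀ (φ : F →+* ℝ) (c : Field.absoluteGaloisGroup F), Literature.NumberTheory.GaloisRepresentations.IsComplexConjugation φ c → ((D.det c : Aˣ) : A) = -1) ∧ (∃ (k : Type) (_ : Field k) (i : IsLocalRing.ResidueField A →+* k) (χ₁ χ₂ : Field.absoluteGaloisGroup F →* kˣ), (D.map (IsLocalRing.residue A)).map i = Literature.NumberTheory.Automorphic.PseudoRep2.ofCharacters χ₁ χ₂)) → (Continuous x₁ ∧ Continuous x₂ ∧ (∀ σ, x₁ (D.trace σ) = (ρ₁ σ).val.trace) ∧ (∀ σ, x₂ (D.trace σ) = ((ρ.restrictField F) σ).val.trace)) → ((∀ (K : Type) [Field K] [NumberField K] [Algebra F K], Module.finrank F K = 2 → (ρ₁.restrictField K).toGaloisRep.IsIrreducible) ∧ (∀ (hF : Literature.NumberTheory.Automorphic.isCompact_glFiniteIntegralLevel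 2 F) (ι : PadicAlgCl 2 ≃+* ℂ), ∃ π₁ : Literature.NumberTheory.Automorphic.CuspidalAutomorphicRepData 2 F hF, π₁.1.IsLAlgebraic ∧ (∃ T : Literature.NumberTheory.Automorphic.InfinityType F 2, π₁.1.HasInfinityType T ∧ T.IsRegular) ∧ Literature.NumberTheory.Automorphic.SatakeFrobCompatibleAE ι π₁.1 ρ₁)) → ∀ (hF : Literature.NumberTheory.Automorphic.isCompact_glFiniteIntegralLevel 2 F) (ι : PadicAlgCl 2 ≃+* ℂ), ∃ π : Literature.NumberTheory.Automorphic.CuspidalAutomorphicRepData 2 F hF, π.1.IsLAlgebraic ∧ (∃ T : Literature.NumberTheory.Automorphic.InfinityType F 2, π.1.HasInfinityType T ∧ T.IsRegular) ∧ Literature.NumberTheory.Automorphic.SatakeFrobCompatibleAE ι π.1 (ρ.restrictField F) := by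
  sorry

/-- **stub_descentToQ** — STUB D, registered form (statement = `S.stub_descentToQ`, see its docstring).
[M (math) / L–XL (Lean), PRINTED modulo assembly: Brauer + cyclic base change ⟹ weakly compatible system over `ℚ` (Taylor 2006 §6 / BLGGT §5.5) ⟹ Khare–Wintenberger + Kisin at a large prime ⟹ newform ⟹ `L`-algebraic `π`.] -/
theorem stub_descentToQ : ∀ (ρ : Literature.NumberTheory.GaloisRepresentations.FramedGaloisRep ℚ (PadicAlgCl 2) 2), ρ.toGaloisRep.IsIrreducible → ρ.IsOdd → (∀ᶠ v : IsDedekindDomain.HeightOneSpectrum (NumberField.RingOfIntegers ℚ) in Filter.cofinite, ρ.IsUnramifiedAt v) → (∀ (v : IsDedekindDomain.HeightOneSpectrum (NumberField.RingOfIntegers ℚ)) (hv : ((2 : ℕ) : NumberField.RingOfIntegers ℚ) ∈ v.asIdeal), (Literature.NumberTheory.PAdicHodge.fontainePstAdicCompletion v 2 hv).IsDeRhamFramed (ρ.toLocal v) ∧ ∀ τ : v.adicCompletion ℚ →+* PadicAlgCl 2, Continuous τ → (ρ.labelledHodgeTateWeightsAt v (Literature.NumberTheory.PAdicHodge.fontainePstAdicCompletion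 v 2 hv).algebra (Literature.NumberTheory.PAdicHodge.fontainePstAdicCompletion v 2 hv).𝔅 τ).Nodup) → ∀ (F : Type) [Field F] [NumberField F], NumberField.IsTotallyReal F → IsGalois ℚ F → (ρ.restrictField F).toGaloisRep.IsIrreducible → (∀ (hF : Literature.NumberTheory.Automorphic.isCompact_glFiniteIntegralLevel 2 F) (ι : PadicAlgCl 2 ≃+* ℂ), ∃ π : Literature.NumberTheory.Automorphic.CuspidalAutomorphicRepData 2 F hF, π.1.IsLAlgebraic ∧ (∃ T : Literature.NumberTheory.Automorphic.InfinityType F 2, π.1.HasInfinityType T ∧ T.IsRegular) ∧ Literature.NumberTheory.Automorphic.SatakeFrobCompatibleAE ι π.1 (ρ.restrictField F)) → ∀ (hcpt : Literature.NumberTheory.Automorphic.isCompact_glFiniteIntegralLevel 2 ℚ) (ι : PadicAlgCl 2 ≃+* ℂ), Literature.NumberTheory.Automorphic.IsAutomorphicAE ι hcpt ρ := by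
  sorry

/-! ## 3. Sanity lemmas (proved): the registered forms ARE the `S.stub_*` statements; the quadratic-field
dichotomy used by the composition -/

theorem stub_inducedCase_iff :
    S.stub_inducedCase ↔ (∀ (ρ : Literature.NumberTheory.GaloisRepresentations.FramedGaloisRep ℚ (PadicAlgCl 2) 2), ρ.toGaloisRep.IsIrreducible → (∀ᶠ v : IsDedekindDomain.HeightOneSpectrum (NumberField.RingOfIntegers ℚ) in Filter.cofinite, ρ.IsUnramifiedAt v) → (∀ (v : IsDedekindDomain.HeightOneSpectrum (NumberField.RingOfIntegers ℚ)) (hv : ((2 : ℕ) : NumberField.RingOfIntegers ℚ) ∈ v.asIdeal), (Literature.NumberTheory.PAdicHodge.fontainePstAdicCompletion v 2 hv).IsDeRhamFramed (ρ.toLocal v) ∧ ∀ τ : v.adicCompletion ℚ →+* PadicAlgCl 2, Continuous τ → (ρ.labelledHodgeTateWeightsAt v (Literature.NumberTheory.PAdicHodge.fontainePstAdicCompletion v 2 hv).algebra (Literature.NumberTheory.PAdicHodge.fontainePstAdicCompletion v 2 hv).𝔅 τ).Nodup) → (∃ (K : Type) (_ : Field K) (_ : NumberField K), Module.finrank ℚ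 K = 2 ∧ ¬ (ρ.restrictField K).toGaloisRep.IsIrreducible) → ∀ (hcpt : Literature.NumberTheory.Automorphic.isCompact_glFiniteIntegralLevel 2 ℚ) (ι : PadicAlgCl 2 ≃+* ℂ), Literature.NumberTheory.Automorphic.IsAutomorphicAE ι hcpt ρ) :=
  Iff.rfl

theorem stub_seededFamily_iff :
    S.stub_seededFamily ↔ (∀ (ρ : Literature.NumberTheory.GaloisRepresentations.FramedGaloisRep ℚ (PadicAlgCl 2) 2), ¬ ρ.IsResiduallyAbsIrreducible → ρ.toGaloisRep.IsIrreducible → ρ.IsOdd → (∀ᶠ v : IsDedekindDomain.HeightOneSpectrum (NumberField.RingOfIntegers ℚ) in Filter.cofinite, ρ.IsUnramifiedAt v) → (∀ (v : IsDedekindDomain.HeightOneSpectrum (NumberField.RingOfIntegers ℚ)) (hv : ((2 : ℕ) : NumberField.RingOfIntegers ℚ) ∈ v.asIdeal), (Literature.NumberTheory.PAdicHodge.fontainePstAdicCompletion v 2 hv).IsDeRhamFramed (ρ.toLocal v) ∧ ∀ τ : v.adicCompletion ℚ →+* PadicAlgCl 2, Continuous τ → (ρ.labelledHodgeTateWeightsAt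 v (Literature.NumberTheory.PAdicHodge.fontainePstAdicCompletion v 2 hv).algebra (Literature.NumberTheory.PAdicHodge.fontainePstAdicCompletion v 2 hv).𝔅 τ).Nodup) → (∀ (K : Type) [Field K] [NumberField K], Module.finrank ℚ K = 2 → (ρ.restrictField K).toGaloisRep.IsIrreducible) → ∃ (F : Type) (_ : Field F) (_ : NumberField F), NumberField.IsTotallyReal F ∧ IsGalois ℚ F ∧ ¬ ((2 : ℤ) ∣ NumberField.discr F) ∧ (∀ w : IsDedekindDomain.HeightOneSpectrum (NumberField.RingOfIntegers F), ((2 : ℕ) : NumberField.RingOfIntegers F) ∈ w.asIdeal → w.residueCard = 2) ∧ (ρ.restrictField F).toGaloisRep.IsIrreducible ∧ ∃ (A : Type) (_ : CommRing A) (_ : IsDomain A) (_ : IsNoetherianRing A) (_ : IsLocalRing A) (_ : TopologicalSpace A) (_ : IsTopologicalRing A) (_ : CompactSpace A) (_ : T2Space A) (D : Literature.NumberTheory.Automorphic.PseudoRep2 (Field.absoluteGaloisGroup F) A) (x₁ x₂ : A →+* PadicAlgCl 2) (ρ₁ : Literature.NumberTheory.GaloisRepresentations.FramedGaloisRep F (PadicAlgCl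 2) 2), (Continuous D.trace ∧ (∃ S : Set (IsDedekindDomain.HeightOneSpectrum (NumberField.RingOfIntegers F)), S.Finite ∧ ∀ v ∉ S, ∀ 𝔓 ∈ v.primesAbove, ∀ σ ∈ 𝔓.inertia (Field.absoluteGaloisGroup F), D.det σ = 1 ∧ ∀ τ : Field.absoluteGaloisGroup F, D.trace (τ * σ) = D.trace τ) ∧ (∀ (φ : F →+* ℝ) (c : Field.absoluteGaloisGroup F), Literature.NumberTheory.GaloisRepresentations.IsComplexConjugation φ c → ((D.det c : Aˣ) : A) = -1) ∧ (∃ (k : Type) (_ : Field k) (i : IsLocalRing.ResidueField A →+* k) (χ₁ χ₂ : Field.absoluteGaloisGroup F →* kˣ), (D.map (IsLocalRing.residue A)).map i = Literature.NumberTheory.Automorphic.PseudoRep2.ofCharacters χ₁ χ₂)) ∧ (Continuous x₁ ∧ Continuous x₂ ∧ (∀ σ, x₁ (D.trace σ) = (ρ₁ σ).val.trace) ∧ (∀ σ, x₂ (D.trace σ) = ((ρ.restrictField F) σ).val.trace)) ∧ ((∀ (K : Type) [Field K] [NumberField K] [Algebra F K], Module.finrank F K = 2 → (ρ₁.restrictField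 K).toGaloisRep.IsIrreducible) ∧ (∀ (hF : Literature.NumberTheory.Automorphic.isCompact_glFiniteIntegralLevel 2 F) (ι : PadicAlgCl 2 ≃+* ℂ), ∃ π₁ : Literature.NumberTheory.Automorphic.CuspidalAutomorphicRepData 2 F hF, π₁.1.IsLAlgebraic ∧ (∃ T : Literature.NumberTheory.Automorphic.InfinityType F 2, π₁.1.HasInfinityType T ∧ T.IsRegular) ∧ Literature.NumberTheory.Automorphic.SatakeFrobCompatibleAE ι π₁.1 ρ₁))) :=
  Iff.rfl

theorem stub_automorphyPropagates_iff :
    S.stub_automorphyPropagates ↔ (∀ (ρ : Literature.NumberTheory.GaloisRepresentations.FramedGaloisRep ℚ (PadicAlgCl 2) 2), ρ.toGaloisRep.IsIrreducible → ρ.IsOdd → (∀ᶠ v : IsDedekindDomain.HeightOneSpectrum (NumberField.RingOfIntegers ℚ) in Filter.cofinite, ρ.IsUnramifiedAt v) → (∀ (v : IsDedekindDomain.HeightOneSpectrum (NumberField.RingOfIntegers ℚ)) (hv : ((2 : ℕ) : NumberField.RingOfIntegers ℚ) ∈ v.asIdeal), (Literature.NumberTheory.PAdicHodge.fontainePstAdicCompletion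 v 2 hv).IsDeRhamFramed (ρ.toLocal v) ∧ ∀ τ : v.adicCompletion ℚ →+* PadicAlgCl 2, Continuous τ → (ρ.labelledHodgeTateWeightsAt v (Literature.NumberTheory.PAdicHodge.fontainePstAdicCompletion v 2 hv).algebra (Literature.NumberTheory.PAdicHodge.fontainePstAdicCompletion v 2 hv).𝔅 τ).Nodup) → ∀ (F : Type) [Field F] [NumberField F], NumberField.IsTotallyReal F → ¬ ((2 : ℤ) ∣ NumberField.discr F) → (∀ w : IsDedekindDomain.HeightOneSpectrum (NumberField.RingOfIntegers F), ((2 : ℕ) : NumberField.RingOfIntegers F) ∈ w.asIdeal → w.residueCard = 2) → (ρ.restrictField F).toGaloisRep.IsIrreducible → ∀ (A : Type) [CommRing A] [IsDomain A] [IsNoetherianRing A] [IsLocalRing A] [TopologicalSpace A] [IsTopologicalRing A] [CompactSpace A] [T2Space A] (D : Literature.NumberTheory.Automorphic.PseudoRep2 (Field.absoluteGaloisGroup F) A) (x₁ x₂ : A →+* PadicAlgCl 2) (ρ₁ : Literature.NumberTheory.GaloisRepresentations.FramedGaloisRep F (PadicAlgCl 2) 2), (Continuous D.trace ∧ (∃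 S : Set (IsDedekindDomain.HeightOneSpectrum (NumberField.RingOfIntegers F)), S.Finite ∧ ∀ v ∉ S, ∀ 𝔓 ∈ v.primesAbove, ∀ σ ∈ 𝔓.inertia (Field.absoluteGaloisGroup F), D.det σ = 1 ∧ ∀ τ : Field.absoluteGaloisGroup F, D.trace (τ * σ) = D.trace τ) ∧ (∀ (φ : F →+* ℝ) (c : Field.absoluteGaloisGroup F), Literature.NumberTheory.GaloisRepresentations.IsComplexConjugation φ c → ((D.det c : Aˣ) : A) = -1) ∧ (∃ (k : Type) (_ : Field k) (i : IsLocalRing.ResidueField A →+* k) (χ₁ χ₂ : Field.absoluteGaloisGroup F →* kˣ), (D.map (IsLocalRing.residue A)).map i = Literature.NumberTheory.Automorphic.PseudoRep2.ofCharacters χ₁ χ₂)) → (Continuous x₁ ∧ Continuous x₂ ∧ (∀ σ, x₁ (D.trace σ) = (ρ₁ σ).val.trace) ∧ (∀ σ, x₂ (D.trace σ) = ((ρ.restrictField F) σ).val.trace)) → ((∀ (K : Type) [Field K] [NumberField K] [Algebra F K], Module.finrank F K = 2 → (ρ₁.restrictField K).toGaloisRep.IsIrreducible) ∧ (∀ (hF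 : Literature.NumberTheory.Automorphic.isCompact_glFiniteIntegralLevel 2 F) (ι : PadicAlgCl 2 ≃+* ℂ), ∃ π₁ : Literature.NumberTheory.Automorphic.CuspidalAutomorphicRepData 2 F hF, π₁.1.IsLAlgebraic ∧ (∃ T : Literature.NumberTheory.Automorphic.InfinityType F 2, π₁.1.HasInfinityType T ∧ T.IsRegular) ∧ Literature.NumberTheory.Automorphic.SatakeFrobCompatibleAE ι π₁.1 ρ₁)) → ∀ (hF : Literature.NumberTheory.Automorphic.isCompact_glFiniteIntegralLevel 2 F) (ι : PadicAlgCl 2 ≃+* ℂ), ∃ π : Literature.NumberTheory.Automorphic.CuspidalAutomorphicRepData 2 F hF, π.1.IsLAlgebraic ∧ (∃ T : Literature.NumberTheory.Automorphic.InfinityType F 2, π.1.HasInfinityType T ∧ T.IsRegular) ∧ Literature.NumberTheory.Automorphic.SatakeFrobCompatibleAE ι π.1 (ρ.restrictField F)) :=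
  Iff.rfl

theorem stub_descentToQ_iff :
    S.stub_descentToQ ↔ (∀ (ρ : Literature.NumberTheory.GaloisRepresentations.FramedGaloisRep ℚ (PadicAlgCl 2) 2), ρ.toGaloisRep.IsIrreducible → ρ.IsOdd → (∀ᶠ v : IsDedekindDomain.HeightOneSpectrum (NumberField.RingOfIntegers ℚ) in Filter.cofinite, ρ.IsUnramifiedAt v) → (∀ (v : IsDedekindDomain.HeightOneSpectrum (NumberField.RingOfIntegers ℚ)) (hv : ((2 : ℕ) : NumberField.RingOfIntegers ℚ) ∈ v.asIdeal), (Literature.NumberTheory.PAdicHodge.fontainePstAdicCompletion v 2 hv).IsDeRhamFramed (ρ.toLocal v) ∧ ∀ τ : v.adicCompletion ℚ →+* PadicAlgCl 2, Continuous τ → (ρ.labelledHodgeTateWeightsAt v (Literature.NumberTheory.PAdicHodge.fontainePstAdicCompletion v 2 hv).algebra (Literature.NumberTheory.PAdicHodge.fontainePstAdicCompletion v 2 hv).𝔅 τ).Nodup) → ∀ (F : Type) [Field F] [NumberField F], NumberField.IsTotallyReal F → IsGalois ℚ F → (ρ.restrictField F).toGaloisRep.IsIrreducible → (∀ (hF :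 Literature.NumberTheory.Automorphic.isCompact_glFiniteIntegralLevel 2 F) (ι : PadicAlgCl 2 ≃+* ℂ), ∃ π : Literature.NumberTheory.Automorphic.CuspidalAutomorphicRepData 2 F hF, π.1.IsLAlgebraic ∧ (∃ T : Literature.NumberTheory.Automorphic.InfinityType F 2, π.1.HasInfinityType T ∧ T.IsRegular) ∧ Literature.NumberTheory.Automorphic.SatakeFrobCompatibleAE ι π.1 (ρ.restrictField F)) → ∀ (hcpt : Literature.NumberTheory.Automorphic.isCompact_glFiniteIntegralLevel 2 ℚ) (ι : PadicAlgCl 2 ≃+* ℂ), Literature.NumberTheory.Automorphic.IsAutomorphicAE ι hcpt ρ) :=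
  Iff.rfl

/-- The composition's case split, named: `ρ` becomes reducible over some quadratic number field (the CM /
induced leg, STUB A) — or it stays irreducible over every quadratic field (the hypothesis of STUB B). [folklore] -/
theorem irreducible_over_quadratic_of_not_induced (ρ : FramedGaloisRep ℚ (PadicAlgCl 2) 2)
    (h : ¬ ∃ (K : Type) (_ : Field K) (_ : NumberField K),
      Module.finrank ℚ K = 2 ∧ ¬ (ρ.restrictField K).toGaloisRep.IsIrreducible) :
    ∀ (K : Type) [Field K] [NumberField K], Module.finrank ℚ K = 2 →
      (ρ.restrictField K).toGaloisRep.IsIrreducible := by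
  intro K _ _ hK
  by_contra hirr
  exact h ⟨K, inferInstance, inferInstance, hK, hirr⟩

/-! ## 4. The composition: the four stubs imply the crux, BY NAME (kernel-checked, no sorry of its own) -/

/-- **The line concludes the crux.**  At the literal prime `2` (`subst`): if `ρ` becomes reducible over a quadratic
field, STUB A; otherwise STUB B gives `F` (totally real, Galois, `2` split) with `ρ|_{Γ_F}` irreducible on a seeded
Eisenstein family, STUB C makes `ρ|_{Γ_F}` automorphic over `F`, STUB D descends to `ℚ`; the goal is
`IsAutomorphicAE ι hcpt ρ` definitionally (`Disproof.automorphicAE_iff`). -/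
theorem DyadicEisensteinFM_of (hA : S.stub_inducedCase) (hB : S.stub_seededFamily)
    (hC : S.stub_automorphyPropagates) (hD : S.stub_descentToQ) :
    Summit.Langlands.Langlands.Theses.DyadicOddResidue.DyadicEisensteinFM := by
  intro ℓ _ hℓ ρ hres hirr hodd hunr hdR hcpt ι
  subst hℓ
  by_cases hCM : ∃ (K : Type) (_ : Field K) (_ : NumberField K),
      Module.finrank ℚ K = 2 ∧ ¬ (ρ.restrictField K).toGaloisRep.IsIrreducible
  · exact hA ρ hirr hunr hdR hCM hcpt ι
  · obtain ⟨F, _, _, hreal, hgal, hdisc, hsplit, hirrF, A, _, _, _, _, _, _, _, _, D, x₁, x₂, ρ₁,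
      hfam, hpts, hseed⟩ :=
      hB ρ hres hirr hodd hunr hdR (irreducible_over_quadratic_of_not_induced ρ hCM)
    exact hD ρ hirr hodd hunr hdR F hreal hgal hirrF
      (hC ρ hirr hodd hunr hdR F hreal hdisc hsplit hirrF A D x₁ x₂ ρ₁ hfam hpts hseed) hcpt ι

/-- **The skeleton**: the crux modulo exactly the four registered stubs (sorries live only inside `stub_*`). -/
theorem DyadicEisensteinFM_proof : Summit.Langlands.Langlands.Theses.DyadicOddResidue.DyadicEisensteinFM :=
  DyadicEisensteinFM_of stub_inducedCase stub_seededFamily stub_automorphyPropagates stub_descentToQ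

end Summit.Langlands.Langlands.Cruxes.DyadicEisensteinFM.CloseApproximationCc

end
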